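import Summits.Schanuel.Schanuel.Theorems.ZilberEacLineSurfaceEscape
import Summits.Schanuel.Schanuel.Theorems.ZilberEacGraphSurfaceExamples
import Summits.Schanuel.Schanuel.Theorems.ZilberEacFibreCurveDensity
import HarnessLib

/-!
# Logarithmic strips, V-c: Zariski density for NON-SPLIT surfaces over a line of non-real slope

HONEST FRAMING.  Cell `pub-schanuel` (Zilber's Exponential-Algebraic Closedness, case ladder;
host summit Schanuel), seat 2, gen 17.  Gen 16 decided every PRODUCT surface over a line of
non-real slope (`unprojectedDense_lineCurveSurfaceC_all`).  Here the fibre may move with the base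
point: **`unprojectedDense_lineSurface_of_im_ne_zero`** — `Im a ≠ 0`, `P ∈ ℂ[x, y₀, y₁]` irreducible
with two monomials of different `y₁`-degree ⟹ `{x₁ = ax₀ + b, P(x₀; y₀, y₁) = 0}` has Zariski-dense
exponential points; with torus fibres over infinitely many base points it is in Mantova–Masser's
case (`mmCase_lineSurface`, the base line having non-rational slope); example
`{x₁ = ix₀, y₁ = x₀y₀}` (`e^{iz} = ze^{z}`); and the complementary class of fibre curves in the
`(x₀, y₀)`-plane over the same lines (`unprojectedDense_lineFibreCurve_of_im_ne_zero`: THEOREM G in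
the coordinate `x₁ = az + b`, whose real part grows linearly along the strip) — so that EVERY
irreducible `P ∉ ℂ[x₀]` with torus fibres gives a dense surface over a line of non-real slope.
What is NOT covered: lines of REAL irrational slope with non-split fibre (seat 1's mechanism for
real slopes is for products), Fib(3,2), EC(3,2).  NOT Schanuel's conjecture (neither used nor implied; EAC ⇏ SC);
`EC(3,2)` stays OPEN; instances of an OPEN question (PLMS 2024, §1 p. 5).
-/

noncomputable section

open Filter Topology Set Complex MvPolynomial
open Literature.NumberTheory.Transcendental Literature.ModelTheory.Zilber
open Literature.ModelTheory.ExponentialFields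

set_option linter.dupNamespace false

namespace Summit.Schanuel.Schanuel.Theorems

section Main

variable (a b : ℂ) {P : MvPolynomial (Fin 3) ℂ}

/-- **Zariski density for non-split surfaces over a line of non-real slope.**  `Im a ≠ 0`;
`P ∈ ℂ[x, y₀, y₁]` irreducible with two monomials of different `y₁`-degree ⟹ the exponential
points of `{x₁ = ax₀ + b, P(x₀; y₀, y₁) = 0} ⊆ ℂ² × ℂ²` are Zariski dense.
[cite: MantovaMasser2023, §1 Further remarks, p. 5 (the question, open in general)] (new) -/
theorem unprojectedDense_lineSurface_of_im_ne_zero (ha : a.im ≠ 0) (hirr : Irreducible P)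
    (h2 : ∃ m ∈ P.support, ∃ m' ∈ P.support, m 2 ≠ m' 2) :
    UnprojectedDense {w : Fin 2 ⊕ Fin 2 → ℂ | w (Sum.inl 1) = (linePoly a b).eval (w (Sum.inl 0)) ∧
      MvPolynomial.eval ![w (Sum.inl 0), w (Sum.inr 0), w (Sum.inr 1)] P = 0} := by
  obtain ⟨z, hz, hgr⟩ := exists_lineSurface_expPoints_of_im_ne_zero a b ha P h2
  exact unprojectedDense_graphSurface_of_expPoints (linePoly a b) P hz hgr
    (isIrreducibleClosed_graphSurface _ hirr) (by rw [zariskiDim_graphSurface _ hirr])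

variable (P)

/-- **The closure of the base is not a line of rational slope** (`Im a ≠ 0`; torus fibres over
infinitely many base points). (new) -/
theorem not_isRationalSlopeLine_lineSurface (ha : a.im ≠ 0)
    (hfib : Set.Infinite {t : ℂ | ∃ c : Fin 2 → ℂ, c 0 ≠ 0 ∧ c 1 ≠ 0 ∧
      MvPolynomial.eval ![t, c 0, c 1] P = 0}) :
    ¬ IsRationalSlopeLine (zeroLocus ℂ (vanishingIdeal ℂ
        (projAdd '' ({w : Fin 2 ⊕ Fin 2 → ℂ | w (Sum.inl 1) = (linePoly a b).eval (w (Sum.inl 0)) ∧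
          MvPolynomial.eval ![w (Sum.inl 0), w (Sum.inr 0), w (Sum.inr 1)] P = 0} ∩
          torusLocus ℂ 2)))) := by
  rw [vanishingIdeal_projAdd_graphSurface (linePoly a b) P hfib]
  exact not_isRationalSlopeLine_graphPolySurface _ Polynomial.X_ne_zero fun m₀ m₁ c h =>
    lineCoeffs_eq_zero b ha m₀ m₁ c fun x => by simpa only [eval_linePoly] using h x

/-- **Case certificate over a line of non-real slope (non-split fibre).** (new) -/
theorem mmCase_lineSurface (ha : a.im ≠ 0) (hirr : Irreducible P)
    (hfib : Set.Infinite {t : ℂ | ∃ c : Fin 2 → ℂ, c 0 ≠ 0 ∧ c 1 ≠ 0 ∧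
      MvPolynomial.eval ![t, c 0, c 1] P = 0}) :
    MMCaseDimPiOneFree {w : Fin 2 ⊕ Fin 2 → ℂ | w (Sum.inl 1) = (linePoly a b).eval (w (Sum.inl 0)) ∧
        MvPolynomial.eval ![w (Sum.inl 0), w (Sum.inr 0), w (Sum.inr 1)] P = 0} := by
  obtain ⟨t, c, h0, h1, hc⟩ := hfib.nonempty
  exact ⟨isIrreducibleClosed_graphSurface _ hirr,
    ⟨_, elim_mem_graphSurface_inter_torusLocus (linePoly a b) P h0 h1 hc⟩,
    zariskiDim_graphSurface _ hirr, addProjDim_graphSurface (linePoly a b) P hfib,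
    not_isRationalSlopeLine_lineSurface a b P ha hfib⟩

variable {P}

/-- **Mantova–Masser's question over a line of non-real slope: case ∧ dense** (any irreducible
`P` with two `y₁`-degrees and torus fibres over infinitely many base points).
[cite: MantovaMasser2023, §1 Further remarks, p. 5 (the question, open in general)] (new) -/
theorem unprojectedDensityQuestion_instance_lineSurface (ha : a.im ≠ 0) (hirr : Irreducible P)
    (h2 : ∃ m ∈ P.support, ∃ m' ∈ P.support, m 2 ≠ m' 2)
    (hfib : Set.Infinite {t : ℂ | ∃ c : Fin 2 → ℂ, c 0 ≠ 0 ∧ c 1 ≠ 0 ∧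
      MvPolynomial.eval ![t, c 0, c 1] P = 0}) :
    MMCaseDimPiOneFree {w : Fin 2 ⊕ Fin 2 → ℂ |
        w (Sum.inl 1) = (linePoly a b).eval (w (Sum.inl 0)) ∧
        MvPolynomial.eval ![w (Sum.inl 0), w (Sum.inr 0), w (Sum.inr 1)] P = 0} ∧
      UnprojectedDense {w : Fin 2 ⊕ Fin 2 → ℂ |
        w (Sum.inl 1) = (linePoly a b).eval (w (Sum.inl 0)) ∧
        MvPolynomial.eval ![w (Sum.inl 0), w (Sum.inr 0), w (Sum.inr 1)] P = 0} :=
  ⟨mmCase_lineSurface a b P ha hirr hfib, unprojectedDense_lineSurface_of_im_ne_zero a b ha hirr h2⟩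

end Main

/-! ## Example: `{x₁ = i x₀, y₁ = x₀ y₀}` (`e^{iz} = z e^{z}`) -/

/-- **Example.**  The non-split surface `{x₁ = ix₀, y₁ = x₀y₀} ⊆ ℂ² × ℂ²` over the line of slope
`i` is in Mantova–Masser's case and its exponential points (`e^{iz} = ze^{z}`) are Zariski dense.
(new) -/
theorem unprojectedDensityQuestion_instance_slopeI_y1_eq_x0y0 :
    MMCaseDimPiOneFree {w : Fin 2 ⊕ Fin 2 → ℂ |
        w (Sum.inl 1) = (linePoly I 0).eval (w (Sum.inl 0)) ∧
        MvPolynomial.eval ![w (Sum.inl 0), w (Sum.inr 0), w (Sum.inr 1)]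
          (X 2 - X 0 * X 1 : MvPolynomial (Fin 3) ℂ) = 0} ∧
      UnprojectedDense {w : Fin 2 ⊕ Fin 2 → ℂ |
        w (Sum.inl 1) = (linePoly I 0).eval (w (Sum.inl 0)) ∧
        MvPolynomial.eval ![w (Sum.inl 0), w (Sum.inr 0), w (Sum.inr 1)]
          (X 2 - X 0 * X 1 : MvPolynomial (Fin 3) ℂ) = 0} :=
  unprojectedDensityQuestion_instance_lineSurface I 0 (by simp) irreducible_PA PA_support_pair
    PA_torusFibres_infinite

/-- The same surface in plain coordinates: `{x₁ = ix₀, y₁ = x₀y₀}` has Zariski-dense exponential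
points. (new) -/
theorem unprojectedDense_slopeI_y1_eq_x0y0 :
    UnprojectedDense {w : Fin 2 ⊕ Fin 2 → ℂ |
      w (Sum.inl 1) = I * w (Sum.inl 0) ∧ w (Sum.inr 1) = w (Sum.inl 0) * w (Sum.inr 0)} := by
  have h := unprojectedDensityQuestion_instance_slopeI_y1_eq_x0y0.2
  have hset : {w : Fin 2 ⊕ Fin 2 → ℂ |
        w (Sum.inl 1) = (linePoly I 0).eval (w (Sum.inl 0)) ∧
        MvPolynomial.eval ![w (Sum.inl 0), w (Sum.inr 0), w (Sum.inr 1)]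
          (X 2 - X 0 * X 1 : MvPolynomial (Fin 3) ℂ) = 0} =
      {w : Fin 2 ⊕ Fin 2 → ℂ |
        w (Sum.inl 1) = I * w (Sum.inl 0) ∧ w (Sum.inr 1) = w (Sum.inl 0) * w (Sum.inr 0)} := by
    ext w
    simp only [Set.mem_setOf_eq, eval_linePoly, add_zero, map_sub, map_mul, MvPolynomial.eval_X,
      Matrix.cons_val_zero, Matrix.cons_val_one, Matrix.cons_val_two, Matrix.tail_cons,
      Matrix.head_cons, sub_eq_zero]
  rw [← hset]
  exact h

/-! ## Fibre curves in the `(x₀, y₀)`-plane over a line of non-real slope -/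

section LineFibreCurve

variable (a b : ℂ) {P : MvPolynomial (Fin 2) ℂ}

/-- **Fibre curves over a line of non-real slope.**  `Im a ≠ 0`; `P ∈ ℂ[x₀, y₀]` irreducible with
two monomials of different `y₀`-degree ⟹ `{x₁ = ax₀ + b, P(x₀, y₀) = 0}` has Zariski-dense
exponential points (`Re(a·i) = -Im a ≠ 0`: the case `deg p = 1` of
`unprojectedDense_fibreCurveSurface`).
[cite: MantovaMasser2023, §1 Further remarks, p. 5 (the question, open in general)] (new) -/
theorem unprojectedDense_lineFibreCurve_of_im_ne_zero (ha : a.im ≠ 0) (hirr : Irreducible P)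
    (h1 : ∃ v ∈ P.support, ∃ v' ∈ P.support, v 1 ≠ v' 1) :
    UnprojectedDense {w : Fin 2 ⊕ Fin 2 → ℂ | w (Sum.inl 1) = (linePoly a b).eval (w (Sum.inl 0)) ∧
      MvPolynomial.eval ![w (Sum.inl 0), w (Sum.inr 0)] P = 0} := by
  have ha0 : a ≠ 0 := by rintro rfl; exact ha (by simp)
  have hd : (linePoly a b).natDegree = 1 := by rw [linePoly, Polynomial.natDegree_linear ha0]
  have hlc : (linePoly a b).leadingCoeff = a := by rw [linePoly, Polynomial.leadingCoeff_linear ha0]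
  refine unprojectedDense_fibreCurveSurface (linePoly a b) (by rw [hd]) ?_ hirr h1
  rw [hlc, hd, pow_one]
  simpa [Complex.mul_re] using ha

/-- **Case certificate for fibre curves over a line of non-real slope.** (new) -/
theorem mmCase_lineFibreCurve (ha : a.im ≠ 0) (hirr : Irreducible P)
    (hfib : Set.Infinite {t : ℂ | ∃ y : ℂ, y ≠ 0 ∧ MvPolynomial.eval ![t, y] P = 0}) :
    MMCaseDimPiOneFree {w : Fin 2 ⊕ Fin 2 → ℂ | w (Sum.inl 1) = (linePoly a b).eval (w (Sum.inl 0)) ∧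
      MvPolynomial.eval ![w (Sum.inl 0), w (Sum.inr 0)] P = 0} := by
  rw [fibreCurveSurface_eq]
  refine mmCase_lineSurface a b _ ha (irreducible_rename_castSucc₂ hirr) (hfib.mono ?_)
  rintro t ⟨y, hy, hty⟩
  refine ⟨![y, 1], by simpa using hy, by simp, ?_⟩
  have e : (![t, (![y, 1] : Fin 2 → ℂ) 0, (![y, 1] : Fin 2 → ℂ) 1] : Fin 3 → ℂ) = ![t, y, 1] := by
    funext i; fin_cases i <;> rfl
  rw [e, eval_vec3_rename_castSucc]
  exact hty

/-- **Question instance: fibre curves over a line of non-real slope, case ∧ dense.** (new) -/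
theorem unprojectedDensityQuestion_instance_lineFibreCurve (ha : a.im ≠ 0) (hirr : Irreducible P)
    (h1 : ∃ v ∈ P.support, ∃ v' ∈ P.support, v 1 ≠ v' 1)
    (hfib : Set.Infinite {t : ℂ | ∃ y : ℂ, y ≠ 0 ∧ MvPolynomial.eval ![t, y] P = 0}) :
    MMCaseDimPiOneFree {w : Fin 2 ⊕ Fin 2 → ℂ |
        w (Sum.inl 1) = (linePoly a b).eval (w (Sum.inl 0)) ∧
        MvPolynomial.eval ![w (Sum.inl 0), w (Sum.inr 0)] P = 0} ∧
      UnprojectedDense {w : Fin 2 ⊕ Fin 2 → ℂ |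
        w (Sum.inl 1) = (linePoly a b).eval (w (Sum.inl 0)) ∧
        MvPolynomial.eval ![w (Sum.inl 0), w (Sum.inr 0)] P = 0} :=
  ⟨mmCase_lineFibreCurve a b ha hirr hfib, unprojectedDense_lineFibreCurve_of_im_ne_zero a b ha hirr h1⟩

/-- **Example.**  `{x₁ = ix₀, y₀² = x₀}` (`e^{2z} = z`, `y₁ = e^{iz}` free): case ∧ dense. (new) -/
theorem unprojectedDensityQuestion_instance_slopeI_y0sq_eq_x0 :
    MMCaseDimPiOneFree {w : Fin 2 ⊕ Fin 2 → ℂ |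
        w (Sum.inl 1) = (linePoly I 0).eval (w (Sum.inl 0)) ∧
        MvPolynomial.eval ![w (Sum.inl 0), w (Sum.inr 0)]
          (X 1 ^ 2 - X 0 : MvPolynomial (Fin 2) ℂ) = 0} ∧
      UnprojectedDense {w : Fin 2 ⊕ Fin 2 → ℂ |
        w (Sum.inl 1) = (linePoly I 0).eval (w (Sum.inl 0)) ∧
        MvPolynomial.eval ![w (Sum.inl 0), w (Sum.inr 0)]
          (X 1 ^ 2 - X 0 : MvPolynomial (Fin 2) ℂ) = 0} :=
  unprojectedDensityQuestion_instance_lineFibreCurve I 0 (by simp) irreducible_X1_sq_sub_X0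
    X1_sq_sub_X0_support_pair X1_sq_sub_X0_fibres_infinite

end LineFibreCurve

end Summit.Schanuel.Schanuel.Theorems
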